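import Summits.AtomisticToContinuum.Crystallization.Theses.FluxTubeKepler
import Summits.AtomisticToContinuum.Crystallization.Theses.PhononSlackCertificates
import Summits.AtomisticToContinuum.Crystallization.Theorems.ReggeStarCoercivityDefectFreeCrystallizesLayeredGluing
import Summits.AtomisticToContinuum.Crystallization.Theorems.PhononSlackCertificatesHullBridgeNonLayeredFraction
import Summits.AtomisticToContinuum.Crystallization.Theorems.PhononSlackCertificatesHullBridgeCleanCentres

/-!
# `FluxCellKepler` (stmt-AtomisticToContinuum-15221), line `Sketch` — the τ-free defect pricing
# from the board's two quantitative-crystallization cruxes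

The registered open stub `stub_defectPricedExcess` of the line (the τ-free shadow of the KEPLER
conjunct of `FluxTubeKepler.FluxCellKepler`: `∀ δ > 0, ∀ R η > 0, ∃ c > 0,
c · #bad_(R,η)(x) ≤ E_LJ(x) − N · ⨅_Q e(Q)` on every finite `δ`-separated injective configuration,
`bad` = sites whose `R`-neighbourhood of relative positions is not two-way `η`-matched with a member
of the relaxed Barlow / layered family) FOLLOWS from the two open cruxes of route
`PhononSlackCertificates`:

* `CoerciveTwoShellGap` (stmt-AtomisticToContinuum-13956): `N e* + g · #{¬ 1/20-two-shell-good} ≤ E`;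
* `NearFieldConvexity` (stmt-AtomisticToContinuum-13958): among two-shell-good sites, the
  non-`η`-layered ones (radius-2 charts) are priced linearly, up to a depth-4 boundary term.

Proof (`stub_defectPricedExcess_of_gaps`).  (1) CLEAN IMPLIES GOOD (`good_of_clean`, the
`t`-controlled form of the gluing lemma `PrestressSplitKorn.LayeredGluing`): for every `(δ, R, η)`
there are `η' > 0` and `R'` such that a site all of whose `R'`-neighbours are `Good` and
`η'`-layered-near is `(R, η)`-layered-good — by contradiction and compactness in the local
matching topology (`exists_subseq_forall_eventually_ballMatch`), the local limit of the recentred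
configurations is exactly layered near every point (`exactNear_of_limit`) hence globally ONE rigid
image of ONE box template (`exactLayeredRigidity_holds`), which, re-based at the origin
(`layeredPos_shift`, `InBox.shift`, `isHaggSeq_shift`), matches the recentred configuration two
ways at scale `(R, η)` for large index.  (2) COUNTING: the exceptional sites (not two-shell-good,
or not `η'`-layered-near) number at most `(E − N e*) · (1/g + (1 + K/g)/c₁)` by the two gaps
(`HullBridgeExact.nl_ineq` turns the near field into a bound on the non-layered count), the sites
within `R'` of an exceptional one at most `(2R'/δ + 1)³` times that
(`squeeze_card_filter_exists_near_le`), and every other site is good by (1).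

So `FluxCellKepler ⇐ CoerciveTwoShellGap ∧ NearFieldConvexity ∧ stub_coerciveFluxCells`
(with the line's skeleton), and the τ-free content of the crux is blocked on exactly the board's
items 13956 / 13958.
-/

noncomputable section

open scoped BigOperators Classical
open Filter Topology

namespace Summit.AtomisticToContinuum.Crystallization.Theorems.FluxCellKeplerSketchGaps

open Summit.AtomisticToContinuum.Crystallization.Theses.PhononSlackCertificates
open Summit.AtomisticToContinuum.Crystallization.Theorems.PrestressSplitKorn
open Summit.AtomisticToContinuum.Crystallization.Theorems.HullBridgeExact
open Summit.AtomisticToContinuum.Crystallization.Theorems.DefectFreeCrystallizes.Negative.PredicateAPI (Good)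
open Literature.MathematicalPhysics.StatisticalMechanics Literature.Geometry.DiscreteGeometry

/-! ## (1) Clean implies good: the `t`-controlled gluing lemma -/

/-- **Clean implies good** (`t`-controlled form of `PrestressSplitKorn.LayeredGluing`).  For every
separation `δ > 0` and scale `(R, η)`, `η > 0`, there are `η' > 0` and `R'` such that in every
`δ`-separated finite configuration, a site `i` all of whose neighbours within `R'` are `Good` and
`η'`-layered-near is `(R, η)`-layered-good: the set of relative positions `x j − x i` is two-way
`η`-matched on the `R`-ball with a layered set `A{k u(a) + l v(a) + L_s(m) w(a) + z(m) e₃}` of the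
box (`a ∈ [47/50, 1]`, Hägg word `s`, increments of `z` in `[39a/50, 17a/20]`).  Compactness and
contradiction, exactly as `PrestressSplitKorn.layeredGluing_of_exactRigidity`, keeping track of the
centre: the exact global template of the local limit is re-based at the origin (a point of the
limit), which puts it in the family with translation `0`. [folklore] -/
theorem good_of_clean : ∀ δ : ℝ, 0 < δ → ∀ R η : ℝ, 0 < η → ∃ η' : ℝ, 0 < η' ∧ ∃ R' : ℝ,
    ∀ (N : ℕ) (x : Fin N → EuclideanSpace ℝ (Fin 3)), (∀ i j : Fin N, i ≠ j → δ ≤ dist (x i) (x j)) →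
    ∀ i : Fin N, (∀ j : Fin N, dist (x j) (x i) ≤ R' → Good x j ∧ LayeredNear η' x j) →
      ∃ a : ℝ, 47 / 50 ≤ a ∧ a ≤ 1 ∧ ∃ (A : EuclideanSpace ℝ (Fin 3) →ₗᵢ[ℝ] EuclideanSpace ℝ (Fin 3)) (s : ℤ → ℤ) (z : ℤ → ℝ), IsHaggSeq s ∧ (∀ m : ℤ, 39 / 50 * a ≤ z (m + 1) - z m ∧ z (m + 1) - z m ≤ 17 / 20 * a) ∧ let S : Set (EuclideanSpace ℝ (Fin 3)) := {p | ∃ m k l : ℤ, p = A (((k : ℝ) • triangularVec₁ a) + ((l : ℝ) • triangularVec₂ a) + ((haggLabel s m : ℝ) • barlowOffset a) + (z m • layerNormal 1))}; (∀ p ∈ S, ‖p‖ ≤ R → ∃ j : Fin N, dist (x j - x i) p ≤ η) ∧ (∀ j : Fin N, ‖x j - x i‖ ≤ R → ∃ p ∈ S, dist (x j - x i) p ≤ η) := by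
  intro δ hδ R η hη
  by_contra H
  have key : ∀ n : ℕ, ∃ (N : ℕ) (x : Fin N → EuclideanSpace ℝ (Fin 3)) (i : Fin N),
      (∀ i j : Fin N, i ≠ j → δ ≤ dist (x i) (x j)) ∧
      (∀ j : Fin N, dist (x j) (x i) ≤ n → Good x j ∧ LayeredNear (1 / ((n : ℝ) + 1)) x j) ∧
      ¬ (∃ a : ℝ, 47 / 50 ≤ a ∧ a ≤ 1 ∧ ∃ (A : EuclideanSpace ℝ (Fin 3) →ₗᵢ[ℝ] EuclideanSpace ℝ (Fin 3)) (s : ℤ → ℤ) (z : ℤ → ℝ), IsHaggSeq s ∧ (∀ m : ℤ, 39 / 50 * a ≤ z (m + 1) - z m ∧ z (m + 1) - z m ≤ 17 / 20 * a) ∧ let S : Set (EuclideanSpace ℝ (Fin 3)) := {p | ∃ m k l : ℤ, p = A (((k : ℝ) • triangularVec₁ a) + ((l : ℝ) • triangularVec₂ a) + ((haggLabel s m : ℝ) • barlowOffset a) + (z m • layerNormal 1))}; (∀ p ∈ S, ‖p‖ ≤ R → ∃ j : Fin N, dist (x j - x i) p ≤ η) ∧ (∀ j : Fin N, ‖x j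 - x i‖ ≤ R → ∃ p ∈ S, dist (x j - x i) p ≤ η)) := by
    intro n
    by_contra hn
    push Not at hn
    exact H ⟨1 / ((n : ℝ) + 1), by positivity, n, fun N x hsep i hi => hn N x i hsep hi⟩
  choose N x i hsep hloc hbad using key
  -- recentred particle sets and their local limit
  set Ys : ℕ → Set (EuclideanSpace ℝ (Fin 3)) := fun n => Set.range fun j => x n j - x n (i n)
    with hYs
  have hYsep : ∀ n, ∀ p ∈ Ys n, ∀ q ∈ Ys n, p ≠ q → δ ≤ dist p q := by
    rintro n _ ⟨j, rfl⟩ _ ⟨j', rfl⟩ hne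
    rw [dist_sub_right]
    exact hsep n j j' fun h => hne (by rw [h])
  obtain ⟨φ, Y, hφ, hYsep', hmatch⟩ := exists_subseq_forall_eventually_ballMatch hδ Ys hYsep
  have hφt : Tendsto φ atTop atTop := hφ.tendsto_atTop
  have hfin : ∀ w : EuclideanSpace ℝ (Fin 3), (Y ∩ Metric.closedBall w 1).Finite := fun w =>
    finite_of_forall_le_dist_of_subset_closedBall hδ (fun p hp q hq => hYsep' p hp.1 q hq.1)
      Set.inter_subset_right
  -- `0 ∈ Y`
  have h0 : (0 : EuclideanSpace ℝ (Fin 3)) ∈ Y := by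
    apply mem_of_forall_exists_dist_le (hfin 0)
    intro γ hγ
    obtain ⟨k, hk⟩ := (hmatch 1 γ hγ).exists
    obtain ⟨y, hy, hd⟩ := hk.2 0 ⟨i (φ k), by simp⟩ (by simp)
    exact ⟨y, hy, by rwa [dist_comm]⟩
  -- every point of `Y` is exactly layered
  have hloc' : ∀ k, ∀ q ∈ Ys (φ k), ‖q‖ ≤ (φ k : ℝ) →
      SetLayeredNear (1 / ((φ k : ℝ) + 1)) (Ys (φ k)) q := by
    rintro k _ ⟨j, rfl⟩ hj
    have := (hloc (φ k) j (by rwa [dist_eq_norm])).2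
    exact setLayeredNear_of_layeredNear this
  have hexact : ∀ p ∈ Y, ExactNear Y p := fun p hp =>
    exactNear_of_limit hδ hYsep' (fun ρ γ hγ => hmatch ρ γ hγ)
      (tendsto_one_div_add_atTop_nhds_zero_nat.comp hφt)
      (tendsto_natCast_atTop_atTop.comp hφt) hloc' hp
  -- the global template, re-based at the origin
  obtain ⟨A, t, a, s, z, hbox, hs, hYeq⟩ :=
    exactLayeredRigidity_holds Y ⟨0, h0⟩ ⟨δ, hδ, hYsep'⟩ hexact
  have h0' := h0
  rw [hYeq] at h0'
  obtain ⟨l₀, hl₀⟩ := h0'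
  rw [zero_add] at hl₀
  set s' : ℤ → ℤ := fun k => s (k + l₀.1) with hs'
  set z' : ℤ → ℝ := fun k => z (k + l₀.1) - z l₀.1 with hz'
  have hbox' : InBox a z' := hbox.shift l₀.1
  have key2 : ∀ l, A (layeredPos a s' z' l) = A (layeredPos a s z (l + l₀)) - t := fun l => by
    rw [hs', hz', layeredPos_shift, map_sub, hl₀]
  have hYeq' : Y = Set.range fun l => A (layeredPos a s' z' l) := by
    ext y
    rw [hYeq]
    constructor
    · rintro ⟨l, hl⟩
      refine ⟨l - l₀, ?_⟩
      show A (layeredPos a s' z' (l - l₀)) = y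
      rw [key2, sub_add_cancel, ← hl, add_sub_cancel_right]
    · rintro ⟨l, rfl⟩
      refine ⟨l + l₀, ?_⟩
      show A (layeredPos a s' z' l) + t = A (layeredPos a s z (l + l₀))
      rw [key2, sub_add_cancel]
  -- matching at scale `(R, η)` for some index gives goodness there: contradiction
  obtain ⟨k, hk⟩ := (hmatch R η hη).exists
  refine hbad (φ k) ⟨a, hbox'.1, hbox'.2.1, A, s', z', isHaggSeq_shift hs _, hbox'.2.2, ?_⟩
  dsimp only
  rw [nl_setOf_eq_range A a s' z', ← hYeq']
  refine ⟨fun p hp hpR => ?_, fun j hj => ?_⟩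
  · obtain ⟨_, ⟨j, rfl⟩, hj⟩ := hk.1 p hp (by rwa [dist_zero_right])
    exact ⟨j, hj⟩
  · obtain ⟨p, hp, hd⟩ := hk.2 _ ⟨j, rfl⟩ (by rwa [dist_zero_right])
    exact ⟨p, hp, hd⟩

/-! ## (2) Counting: the pricing from the two gaps -/

/-- **The τ-free defect pricing from `CoerciveTwoShellGap` and `NearFieldConvexity`** (registered
helper `stub_defectPricedExcess_of_gaps` of line `Sketch`; its conclusion is verbatim the
registered stub `stub_defectPricedExcess`).  Given `(δ, R, η)`, take `(η', R')` from
`good_of_clean`, `g` from the coercive gap at `δ`, `(c₁, C₁)` from the near field at `(δ, η')`.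
On a `δ`-separated injective `x` with excess `X = E − N e* ≥ 0`: the non-two-shell-good sites
number `T ≤ X / g`; the non-`η'`-layered ones `≤ (X + K T)/c₁` (`nl_ineq`, `K = K(δ, C₁, c₁)`);
the sites within `max R' 0` of an exceptional one at most `(2 max R' 0/δ + 1)³` times their number
(`squeeze_card_filter_exists_near_le`); all other sites are `(R, η)`-good by `good_of_clean`
(two-shell-good ⇒ `Good`, `cc_good_of_isTwoShellGood`).  Hence `#bad ≤ L X` with `L` depending
on `(δ, R, η)` only, and `c := 1/(L + 1)` works. [folklore] -/
theorem stub_defectPricedExcess_of_gaps : Summit.AtomisticToContinuum.Crystallization.Theses.PhononSlackCertificates.CoerciveTwoShellGap → Summit.AtomisticToContinuum.Crystallization.Theses.PhononSlackCertificates.NearFieldConvexity → ∀ δ : ℝ, 0 < δ → ∀ R η : ℝ, 0 < R → 0 < η → ∃ c : ℝ, 0 < c ∧ ∀ (N : ℕ) (x : Fin N → EuclideanSpace ℝ (Fin 3)), Function.Injective x → (∀ i j, i ≠ j → δ ≤ dist (x i) (x j)) → c * (Nat.card {i : Fin N // ¬ ∃ a : ℝ, 47 / 50 ≤ a ∧ a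 ≤ 1 ∧ ∃ (A : EuclideanSpace ℝ (Fin 3) →ₗᵢ[ℝ] EuclideanSpace ℝ (Fin 3)) (s : ℤ → ℤ) (z : ℤ → ℝ), IsHaggSeq s ∧ (∀ m : ℤ, 39 / 50 * a ≤ z (m + 1) - z m ∧ z (m + 1) - z m ≤ 17 / 20 * a) ∧ let S : Set (EuclideanSpace ℝ (Fin 3)) := {p | ∃ m k l : ℤ, p = A (((k : ℝ) • triangularVec₁ a) + ((l : ℝ) • triangularVec₂ a) + ((haggLabel s m : ℝ) • barlowOffset a) + (z m • layerNormal 1))}; (∀ p ∈ S, ‖p‖ ≤ R → ∃ j : Fin N, dist (x j - x i) p ≤ η) ∧ (∀ j : Fin N, ‖x j - x i‖ ≤ R → ∃ p ∈ S, dist (x j - x i) p ≤ η)} : ℝ) ≤ interactionEnergy lennardJones x - (N : ℝ) * ⨅ Q : PeriodicConfiguration 3, Q.energyPerParticle lennardJones := by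
  intro hCG hNF δ hδ R η hR hη
  obtain ⟨η', hη', R', hA⟩ := good_of_clean δ hδ R η hη
  obtain ⟨g, hg, hgap⟩ := hCG δ hδ
  obtain ⟨c₁, hc₁, C₁, hmain⟩ := hNF δ hδ η' hη'
  set e : ℝ := ⨅ Q : PeriodicConfiguration 3, Q.energyPerParticle lennardJones with he
  set K : ℝ := max C₁ 0 * (2 * 4 / δ + 1) ^ 3 + (125 / 6 * δ⁻¹ ^ 6 + |e|) + c₁ with hK
  have hK0 : 0 ≤ K :=
    add_nonneg (add_nonneg (mul_nonneg (le_max_right _ _) (by positivity)) (by positivity)) hc₁.le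
  set ρ : ℝ := max R' 0 with hρ
  set M : ℝ := (2 * ρ / δ + 1) ^ 3 with hM
  have hρ0 : 0 ≤ ρ := le_max_right _ _
  have hM0 : 0 ≤ M := by positivity
  set Lc : ℝ := 1 / g + (1 + K / g) / c₁ with hLc
  have hLc0 : 0 ≤ Lc := by positivity
  set L : ℝ := M * Lc with hL
  have hL0 : 0 ≤ L := mul_nonneg hM0 hLc0
  refine ⟨1 / (L + 1), by positivity, fun N x hx hsep => ?_⟩
  -- the two-shell-good set and the counts
  set Ω := Finset.univ.filter fun i : Fin N => IsTwoShellGood (1 / 20) (47 / 50) 1 x i with hΩ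
  have hgood : ∀ i ∈ Ω, IsTwoShellGood (1 / 20) (47 / 50) 1 x i := fun i hi =>
    (Finset.mem_filter.1 hi).2
  have hcompl : Nat.card {i : Fin N // ¬ IsTwoShellGood (1 / 20) (47 / 50) 1 x i} = (Ωᶜ).card := by
    rw [Nat.card_eq_fintype_card, Fintype.card_subtype]
    congr 1
    ext i
    simp [hΩ]
  set T : ℝ := (Nat.card {i : Fin N // ¬ IsTwoShellGood (1 / 20) (47 / 50) 1 x i} : ℝ) with hT
  set X : ℝ := interactionEnergy lennardJones x - (N : ℝ) * e with hX
  set NL := Finset.univ.filter fun i : Fin N => ¬ LayeredNear η' x i with hNL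
  set D := Finset.univ.filter fun j : Fin N =>
    ¬ (IsTwoShellGood (1 / 20) (47 / 50) 1 x j ∧ LayeredNear η' x j) with hD
  set B := Finset.univ.filter fun i : Fin N => ∃ j ∈ D, dist (x j) (x i) ≤ ρ with hB
  -- (a) the coercive gap: `g T ≤ X`, so `X ≥ 0` and `T ≤ X / g`
  have h1 : g * T ≤ X := by
    have := hgap N x hsep
    rw [hX, hT]
    linarith
  have hT0 : 0 ≤ T := by rw [hT]; positivity
  have hX0 : 0 ≤ X := le_trans (mul_nonneg hg.le hT0) h1
  have hTle : T ≤ X / g := by rw [le_div_iff₀ hg]; linarith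
  -- (b) the near field on `Ω`: `c₁ #NL ≤ X + K T`
  have h0 : c₁ * ((Ω.filter fun i => ¬ LayeredNear η' x i).card : ℝ)
      - C₁ * ((Ω.filter fun i => ∃ j : Fin N, j ∉ Ω ∧ dist (x j) (x i) ≤ 4).card : ℝ)
      ≤ ∑ i ∈ Ω, ((1 / 2 : ℝ) * siteEnergy lennardJones x i -
          (⨅ Q : PeriodicConfiguration 3, Q.energyPerParticle lennardJones)) := by
    rw [← nl_card_inline_eq η' x Ω, ← nl_card_bdry_eq x Ω 4]
    exact hmain N x hsep Ω hgood
  have h2 : c₁ * (NL.card : ℝ) ≤ X + K * T := by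
    have := nl_ineq hδ hc₁ hsep Ω h0
    rw [← hcompl] at this
    simpa only [hNL, hX, hK, hT, he] using this
  have hNLle : (NL.card : ℝ) ≤ (X + K * (X / g)) / c₁ := by
    rw [le_div_iff₀ hc₁]
    have : K * T ≤ K * (X / g) := mul_le_mul_of_nonneg_left hTle hK0
    linarith
  -- (c) exceptional and blocked sites
  have hDle : (D.card : ℝ) ≤ T + NL.card := by
    have := cc_card_bad_le x η'
    simpa only [hD, hT, hNL] using this
  have hBle : (B.card : ℝ) ≤ M * D.card := squeeze_card_filter_exists_near_le hδ hρ0 hsep D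
  -- (d) a site outside `B` is clean out to radius `R'`, hence `(R, η)`-good
  have hclean : ∀ i : Fin N, i ∉ B →
      ∀ j : Fin N, dist (x j) (x i) ≤ R' → Good x j ∧ LayeredNear η' x j := by
    intro i hiB j hj
    have hjD : j ∉ D := fun hjD =>
      hiB (Finset.mem_filter.2 ⟨Finset.mem_univ _, j, hjD, hj.trans (le_max_left _ _)⟩)
    have hj' : IsTwoShellGood (1 / 20) (47 / 50) 1 x j ∧ LayeredNear η' x j := by
      by_contra hno
      exact hjD (Finset.mem_filter.2 ⟨Finset.mem_univ _, hno⟩)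
    exact ⟨cc_good_of_isTwoShellGood hx hj'.1, hj'.2⟩
  have hbadle : (Nat.card {i : Fin N // ¬ ∃ a : ℝ, 47 / 50 ≤ a ∧ a ≤ 1 ∧ ∃ (A : EuclideanSpace ℝ (Fin 3) →ₗᵢ[ℝ] EuclideanSpace ℝ (Fin 3)) (s : ℤ → ℤ) (z : ℤ → ℝ), IsHaggSeq s ∧ (∀ m : ℤ, 39 / 50 * a ≤ z (m + 1) - z m ∧ z (m + 1) - z m ≤ 17 / 20 * a) ∧ let S : Set (EuclideanSpace ℝ (Fin 3)) := {p | ∃ m k l : ℤ, p = A (((k : ℝ) • triangularVec₁ a) + ((l : ℝ) • triangularVec₂ a) + ((haggLabel s m : ℝ) • barlowOffset a) + (z m • layerNormal 1))}; (∀ p ∈ S, ‖p‖ ≤ R → ∃ j : Fin N, dist (x j - x i) p ≤ η) ∧ (∀ j : Fin N, ‖x j - x i‖ ≤ R → ∃ p ∈ S, dist (x j - x i) p ≤ η)} : ℝ) ≤ B.card := by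
    have hle : Nat.card {i : Fin N // ¬ ∃ a : ℝ, 47 / 50 ≤ a ∧ a ≤ 1 ∧ ∃ (A : EuclideanSpace ℝ (Fin 3) →ₗᵢ[ℝ] EuclideanSpace ℝ (Fin 3)) (s : ℤ → ℤ) (z : ℤ → ℝ), IsHaggSeq s ∧ (∀ m : ℤ, 39 / 50 * a ≤ z (m + 1) - z m ∧ z (m + 1) - z m ≤ 17 / 20 * a) ∧ let S : Set (EuclideanSpace ℝ (Fin 3)) := {p | ∃ m k l : ℤ, p = A (((k : ℝ) • triangularVec₁ a) + ((l : ℝ) • triangularVec₂ a) + ((haggLabel s m : ℝ) • barlowOffset a) + (z m • layerNormal 1))}; (∀ p ∈ S, ‖p‖ ≤ R → ∃ j : Fin N, dist (x j - x i) p ≤ η) ∧ (∀ j : Fin N, ‖x j - x i‖ ≤ R → ∃ p ∈ S, dist (x j - x i) p ≤ η)} ≤ Nat.card {i : Fin N // i ∈ B} := by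
      rw [Nat.card_eq_fintype_card, Nat.card_eq_fintype_card]
      refine Fintype.card_subtype_mono _ _ fun i hi => ?_
      by_contra hiB
      exact hi (hA N x hsep i (hclean i hiB))
    rw [Nat.card_eq_finsetCard] at hle
    exact_mod_cast hle
  -- (e) arithmetic
  have hsum : T + NL.card ≤ X * Lc := by
    have : X / g + (X + K * (X / g)) / c₁ = X * Lc := by
      rw [hLc]
      ring
    linarith
  have hbad : (Nat.card {i : Fin N // ¬ ∃ a : ℝ, 47 / 50 ≤ a ∧ a ≤ 1 ∧ ∃ (A : EuclideanSpace ℝ (Fin 3) →ₗᵢ[ℝ] EuclideanSpace ℝ (Fin 3)) (s : ℤ → ℤ) (z : ℤ → ℝ), IsHaggSeq s ∧ (∀ m : ℤ, 39 / 50 * a ≤ z (m + 1) - z m ∧ z (m + 1) - z m ≤ 17 / 20 * a) ∧ let S : Set (EuclideanSpace ℝ (Fin 3)) := {p | ∃ m k l : ℤ, p = A (((k : ℝ) • triangularVec₁ a) + ((l : ℝ) • triangularVec₂ a) + ((haggLabel s m : ℝ) • barlowOffset a) + (z m • layerNormal 1))}; (∀ p ∈ S, ‖p‖ ≤ R → ∃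 j : Fin N, dist (x j - x i) p ≤ η) ∧ (∀ j : Fin N, ‖x j - x i‖ ≤ R → ∃ p ∈ S, dist (x j - x i) p ≤ η)} : ℝ) ≤ L * X :=
    calc (Nat.card {i : Fin N // ¬ ∃ a : ℝ, 47 / 50 ≤ a ∧ a ≤ 1 ∧ ∃ (A : EuclideanSpace ℝ (Fin 3) →ₗᵢ[ℝ] EuclideanSpace ℝ (Fin 3)) (s : ℤ → ℤ) (z : ℤ → ℝ), IsHaggSeq s ∧ (∀ m : ℤ, 39 / 50 * a ≤ z (m + 1) - z m ∧ z (m + 1) - z m ≤ 17 / 20 * a) ∧ let S : Set (EuclideanSpace ℝ (Fin 3)) := {p | ∃ m k l : ℤ, p = A (((k : ℝ) • triangularVec₁ a) + ((l : ℝ) • triangularVec₂ a) + ((haggLabel s m : ℝ) • barlowOffset a) + (z m • layerNormal 1))}; (∀ p ∈ S, ‖p‖ ≤ R → ∃ j : Fin N, dist (x j - x i) p ≤ η) ∧ (∀ j : Fin N, ‖x j - x i‖ ≤ R → ∃ p ∈ S, dist (x j - x i) p ≤ η)} : ℝ) ≤ B.card := hbadle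
      _ ≤ M * D.card := hBle
      _ ≤ M * (T + NL.card) := mul_le_mul_of_nonneg_left hDle hM0
      _ ≤ M * (X * Lc) := mul_le_mul_of_nonneg_left hsum hM0
      _ = L * X := by rw [hL]; ring
  rw [one_div, inv_mul_le_iff₀ (by positivity)]
  nlinarith

end Summit.AtomisticToContinuum.Crystallization.Theorems.FluxCellKeplerSketchGaps

end
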